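import Summits.AtomisticToContinuum.FouriersLaw.Theses.HonestZwanzig

/-!
# Disproof of `PositiveMemory` — work file of the crux disprover (gen 1 cycle 1 + gen 2 cycle 1 + gen 3 cycle 1)

Crux `stmt-AtomisticToContinuum-12694` = `Summit.AtomisticToContinuum.FouriersLaw.Theses.HonestZwanzig.PositiveMemory`
(route `HonestZwanzig`, rank 3): for `pinnedChain ω₂ lam β γ` (all `> 0`) and `T > 0` there are `k₀ > 0`, `R` with
`ρ_b ≥ k₀` for every `N ≥ 2`, every bulk bond `b` (distance `≥ R` from both ends) and every limit
`ρ_b = lim_{s↓0} schur_s(j_b, J)`.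

FINDINGS (details in the docstrings below; prose lives only in docstrings/comments):

* §1 LOAD-BEARING ANALYSIS. `0 < T` is load-bearing only through NORMALISABILITY of the Gibbs weight: at `T = 0`
  Lean's `x / 0 = 0` makes `gibbsMeasure N 0 = volume.tilted 0 = 0` (infinite Lebesgue volume), every `corr/lap/schur`
  vanishes identically, the limit `ρ_b = 0` EXISTS, and no `k₀ > 0` works:
  `positiveMemory_false_without_TPos : ¬ PositiveMemoryWithoutTPos` (PROVED, no sorry). The same mechanism kills the
  variants with `T < 0`, `lam < 0` or `β < 0` (weight `e^{+|H|/T}` resp. `H → -∞` along the diagonal: not integrable ⇒ zero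
  measure) — recorded, not formalised (non-integrability of `e^{-H/T}` for `lam < 0` is a chore with no information).
  `0 < ω₂`, `0 < lam`, `0 < β` with the OTHER sign (`= 0`) are NOT load-bearing for the truth of the statement as far as
  any cheap attack can see: `lam = 0` (harmonic pinning + FPU-β) and `β = 0` (φ⁴ chain) are expected normal conductors, and
  even the harmonic member `lam = β = 0` has `ρ_b ≈ +2.9 N → +∞ ≥ k₀` (ideator kit j015397, `KitResults-ideator2`), i.e. the
  floor holds there WITH ROOM — ballistic transport makes `ρ_b` large, not small. `0 < γ`: at `γ = 0` the chain is isolated,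
  `corr` does not decay, `lap_s ∼ 1/s`; nothing cheap decides the Schur complement's `s ↓ 0` behaviour (open).
* §2 REDUNDANT GUARD. `2 ≤ N` is implied by the bulk condition `R ≤ b.val ∧ b.val + 2 + R ≤ N` (`b : Fin N`):
  `positiveMemory_iff_noNGuard` (PROVED) — information for the prover, the guard costs nothing.
* §3 WHY IT RESISTS (no kill): (a) no junk for the actual parameters — for `s > 0`, `G(s)` is positive definite
  (`ξᵀG(s)ξ = ⟨h,(s-L)⁻¹h⟩_μ`, real part `≥ s‖(s-L)⁻¹h‖² > 0`, the centred `e_x` being linearly independent), so `(G s)⁻¹`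
  is the true inverse, and `schur_s(f,g) = ⟨Q f̄, (s − QLQ)⁻¹ Q ḡ⟩_μ` EXACTLY (block-inverse identity
  `D⁻¹ = Z − Y W⁻¹ X`, no self-adjointness needed), `Q` = `L²(μ)`-orthoprojection off `span{1, e_x}`; (b) the conclusion
  quantifies "∀ ρ, Tendsto … → k₀ ≤ ρ", so a NON-existent limit is harmless to the statement and only an existing SMALL limit
  refutes it; (c) summing over bonds, `Σ_b ρ_b = schur_0(J,J) ≥ lap_0(J,J) = (N−1)T²D_N > 0` (circuit identity of the landed
  `NetworkReduction` + KDN), so the bond AVERAGE of `ρ_b` is at least `T²D_N ≈ T²κ`; a failure needs bulk INHOMOGENEITY of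
  `ρ_b` or `κ = 0`, i.e. `PositiveMemory` is morally `κ_GK(T) > 0` plus locality — the conjunct itself. (d) Mode coupling
  (§4) changes `K(k,0)` only by `+c|k|`, leaving `K(0,0) = χD > 0`: it does not threaten the crux.
  Barriers consulted: `HarmonicCrystalBallistic` / `MazurBoundBallistic(OpenChain)` push `ρ_b` UP, not down;
  `StrongPinningBreathers` (Hairer–Mattingly) is excluded by `β > 0` (CEHR C5); `AnticontinuumLocalization` /
  `LowTemperatureWeakAnharmonicity` concern parameter limits, while `k₀` may depend on all parameters; `SpectralGapClosing`
  is embraced by the route. `ledger negatives`: nothing near this item.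
* §4 LINE `Sketch` (picked): stubs S1–S3 are sound (S3 provable now: `Var(E_ζ) ≥ Var(Σζ_x p_x²/2) = (T²/2)Σζ²`,
  momenta i.i.d. `N(0,T)` ⊥ positions); S4 `TentEscape` is "energy leaves diffusively" (= a conductivity LOWER bound, the
  crux in disguise, not cheaper); **S5 `stub_apexLocality` IS MISSTATED**: one-loop nonlinear fluctuating hydrodynamics for
  ONE conserved field in d = 1 gives the orthogonal-dynamics bond memory kernel a cusp `K(k,0) = χD(1 + A|k| + O(k²))`,
  `A = (d ln D/d ln T)²/(4c) > 0` (`c = χ/T²`), i.e. a real-space tail `K(z) ≈ −(AχD/π) z⁻²`; the cross-apex memory is then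
  `≈ −(2AχD/π) log N → −∞`, so `schur_s(J_ξ,J_ξ) − schur_s(J,J) ≈ +(4AχD/π) log N` is NOT bounded by a constant `C_A`.
  The reduction `PositiveMemory_of` survives with the weaker `schur_s(J_ξ,J_ξ) ≤ schur_s(J,J) + o(N)` (it only needs
  `Σ_b ρ_b ≥ cN − o(N)`), so the repair is cheap: restate S5 with `C_A · (1 + Real.log N)` (or any `o(N)`).
  Numerical test of the MECHANISM on the actual chain (periodic `pinnedChain 1 1 1 1`, equilibrium MD, integrated relaxation
  rate `Γ(k)/k̃² = K(k,0)/χ_k` of the energy modes): kit jobs listed in `kcusp_evidence` below.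
  (gen 2 note: gen-1's job j017224 finished 2026-08-16T13:14Z with 4 artifacts, but its outputs are not readable from the
  gen-2 seat — `kit compute fetch` is owner-locked; `compute-j017224.json` is attached to the item for the lead/planner.)
* §5 (GEN 2, 2026-08-16, seat `refuter-cdisprove-…-12694-g2-0`; details in the §5 docblock at the end of the file).
  (a) RIGHT MARGIN LOAD-BEARING (LANDED `Theorems/PositiveMemory/Negative/FalseWithoutRightMargin.lean`, p106337):
  deleting `b.val + 2 + R ≤ N` makes every slice false through the phantom index `b = N − 1` (`bondCurrent = 0`); the honest
  weakening `b.val + 1 < N` (floor up to the contact bond) is open and equals dropping the LEFT margin by reflection.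
  (b) SCALING NORMAL FORM (p107293, `Theorems/PositiveMemory/Negative/ScalingNormalForm.lean`, sorry-free, rc 0): the
  amplitude scaling conjugates every layer of the Schur gadget, `schur^{lam,β}_{T,σ}(j_b,J) = a⁴·schur^{lam a²,β a²}_{T/a²,σ}(j_b,J)`
  for EVERY real `σ`; hence `PositiveMemory ↔ its T = 1 slice over all couplings`, `k₀(lam,β,T) = T²·k₀(lamT,βT,1)`:
  WLOG `T = 1`; no temperature corner is load-bearing; `T`-uniform strengthenings are coupling-ray growth statements.
  (c) RESISTOR CALIBRATION (tightness of the floor; `resistor_calibration` below): in the nearest-neighbour resistor model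
  (bulk conductance `K = χD` per bond, contact conductance `γT²`, Robin length `ℓ = K/(γT²)`) the Schur floor is EXACTLY the
  bulk symbol, `ρ_b = K` for every bond (contacts included) and every `N ≥ 2`, while `lap_0(j_b,J) = K(N−1)/(N−1+2ℓ)`: the
  Schur complement removes the contact resistance exactly, so `R = 0` is the expected truth, `k₀ ≤ T²κ` is forced and
  `k₀ = T²κ − 0` is the sharp value; `PositiveMemory` has no contact content — it is "κ > 0 + bulk locality".
  (d) LINE `Sketch` v3 (13:15Z: `stub_apexLocalityEps`, `stub_robinReduction`, `stub_tentReduction`): the ε-form of apex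
  locality follows from `N`-uniform ABSOLUTE summability of the bulk bond-memory kernel (`Σ_z|K(z)| < ∞ ⇒ Σ_{z≤N} z|K(z)| =
  o(N)`), i.e. from the `UniformLocality` layer of `OrthogonalOhm`'s two-layer plan, and is consistent with §4's `−c/z²`
  tail (absolutely summable): the gen-1 objection is fully answered by v3; no cheap attack remains on it or on
  `stub_tentEscape` (both hold in the diffusive calibration, `ξᵀG(0)ξ ≈ (8/π⁶)(χ/D)N⁵`). The v3 skeleton TEXT is not visible
  to this seat (ledger signatures truncate at `let P`; `Lines/Sketch.lean` here is v0) — request to the lead: write v3 back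
  to `Cruxes/PositiveMemory/Lines/Sketch.lean` per the crux protocol, so attacks can be type-checked against the real stubs.
  (e) NUMERICS — the planner's DISCRIMINATING TEST on the anharmonic OPEN chain (never run before): equilibrium MD,
  `ρ_b(s) = schur_s(j_b,J)` for every bond, `s ∈ {0.01,…,0.5}`, `N ∈ {3,…,16}`, two contact strengths `γ ∈ {1, 0.1}`, member
  `pinnedChain 1 8 0.5 γ` at `T = 4` (diffusive) and the literal `1 1 1 1` at `T = 1`, MD estimators validated against the
  exact Gaussian computation on the harmonic member at the same `s`: kit jobs in `numerics_gen2` below; the table is folded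
  in when they land. Prediction to beat (resistor calibration): `ρ_b(0⁺) ≈ K` flat in `b` INCLUDING the contact bonds while
  `lap_0(j_b,J) ≈ K(N−1)/(N−1+2ℓ)`, i.e. `ρ_b / lap_0(j_b,J) ≈ 1 + 2ℓ/(N−1)` — large for `γ = 0.1`.
* §6 (GEN 3, 2026-08-16, seat `refuter-cdisprove-…-12694-g3-0`; details in the §6 docblock at the end of the file).
  (a) FORMAL STATUS: `PositiveMemory_of : OrthogonalOhm → ConductanceLowerBound → PositiveMemory` (p120416) and the necessity chain
  `OrthogonalOhm → FouriersLaw → PositiveMemory` (landed compositions) ⇒ `¬PositiveMemory → OrthogonalOhm → ¬FouriersLaw`: no attack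
  surface on crux #3 that is not an attack on the conjunct or on crux #2. (b) EXISTENCE BARRIER + FixedNLap-modulo-det, LANDED as
  `Theorems/PositiveMemory/Negative/ExistenceBarrier.lean` (p126176): every refutation must PRODUCE a limit (`kill_shape`); if
  `det G₀ ≠ 0` (`G₀ = [∫₀^∞corr(e_x,e_y)]`) every `ρ_b` EXISTS at fixed `N` and equals the explicit `schur₀(j_b,J)`; under that
  non-degeneracy the crux is EQUIVALENT to the existence-free floor `k₀ ≤ schur₀(j_b,J)`; `Negative/NonDegeneracy.lean` (p126437):
  `G₀` symmetric PSD, `det G₀ ≠ 0 ↔` every nonzero energy profile has `∫₀^∞corr(h,h) > 0`; blueprint (three commutators) for it. (c) `γ = 0` (isolated chain): unprojected DC response vanishes (`j_b` is a Liouville coboundary), projected one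
  undecidable cheaply. (d) complete load-bearing table; `positiveMemory_iff_tail` (the crux is a tail statement in `N`).
  (e) gen-2 kit tables unrecoverable from this seat (owner-locked); lead c7 runs the MD; literature search degraded.
-/

noncomputable section

open MeasureTheory Filter Topology Set
open scoped ENNReal

namespace Summit.AtomisticToContinuum.FouriersLaw.Cruxes.PositiveMemory.Disproof

open Literature.MathematicalPhysics.KineticTheory.HeatConduction

/-! ## §1 Load-bearing analysis: the temperature sign -/

/-- `PositiveMemory` with the hypothesis `0 < T` WEAKENED to `0 ≤ T` (everything else verbatim). -/
def PositiveMemoryWithoutTPos : Prop :=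
  ∀ ω₂ lam β γ : ℝ, 0 < ω₂ → 0 < lam → 0 < β → 0 < γ → ∀ T : ℝ, 0 ≤ T → ∃ k₀ : ℝ, 0 < k₀ ∧ ∃ R : ℕ, ∀ N : ℕ, 2 ≤ N → let P := Literature.MathematicalPhysics.KineticTheory.HeatConduction.pinnedChain ω₂ lam β γ; let X := Literature.MathematicalPhysics.KineticTheory.HeatConduction.PhaseSpace N; let μ : MeasureTheory.Measure X := P.gibbsMeasure N T; let corr : (X → ℝ) → (X → ℝ) → ℝ → ℝ := fun f g t => (∫ z, f z * (∫ y, g y ∂(P.transitionKernel N T T t.toNNReal z)) ∂μ) - (∫ z, f z ∂μ) * (∫ z, g z ∂μ); let lap : ℝ → (X → ℝ) → (X → ℝ) → ℝ := fun s f g => ∫ t in Set.Ioi (0 : ℝ), Real.exp (-(s * t)) * corr f g t; let e : Fin N → X → ℝ := fun x z => z.2 x ^ 2 / 2 + P.U (z.1 x) + ∑ j : Fin N, ((if j.val = x.val + 1 then P.V (z.1 j - z.1 x) / 2 else 0) + (if x.val = j.val + 1 then P.V (z.1 x - z.1 j) / 2 else 0)); let G : ℝ → Matrix (Fin N) (Fin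 N) ℝ := fun s => Matrix.of fun x y => lap s (e x) (e y); let schur : ℝ → (X → ℝ) → (X → ℝ) → ℝ := fun s f g => lap s f g - ∑ x : Fin N, ∑ y : Fin N, lap s f (e x) * (G s)⁻¹ x y * lap s (e y) g; let J : X → ℝ := fun z => ∑ i : Fin N, P.bondCurrent N i z; ∀ b : Fin N, R ≤ b.val → b.val + 2 + R ≤ N → ∀ ρ : ℝ, Filter.Tendsto (fun s => schur s (P.bondCurrent N b) J) (nhdsWithin (0 : ℝ) (Set.Ioi 0)) (nhds ρ) → k₀ ≤ ρ

/-- Lebesgue measure of a phase space with at least one site is infinite. -/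
theorem volume_phaseSpace_univ {N : ℕ} (hN : N ≠ 0) :
    (volume : Measure (PhaseSpace N)) Set.univ = ∞ := by
  have h1 : (volume : Measure (Fin N → ℝ)) Set.univ = ∞ := by
    rw [volume_pi, Measure.pi_univ]
    simp only [Real.volume_univ, Finset.prod_const, Finset.card_univ, Fintype.card_fin]
    exact ENNReal.top_pow hN
  rw [MeasureTheory.Measure.volume_eq_prod, ← Set.univ_prod_univ, Measure.prod_prod, h1, ENNReal.top_mul_top]

/-- At `T = 0` the Gibbs "density" is `e^{-H/0} = e^0 = 1` (Lean: `x / 0 = 0`), which is not integrable on an infinite-volume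
phase space, so Mathlib's `Measure.tilted` returns the ZERO measure: `gibbsMeasure N 0 = 0` for every chain and every `N ≥ 1`. -/
theorem gibbsMeasure_zero_temp (P : OscillatorChain) {N : ℕ} (hN : N ≠ 0) : P.gibbsMeasure N 0 = 0 := by
  have hf : (fun x : PhaseSpace N => -P.hamiltonian N x / (0 : ℝ)) = fun _ => (0 : ℝ) := by
    funext x; simp
  rw [OscillatorChain.gibbsMeasure, hf, tilted_const', volume_phaseSpace_univ hN, ENNReal.inv_top, zero_smul]

/-- **`0 < T` is load-bearing (through normalisability only).** With `0 ≤ T` allowed, take `T = 0`: the equilibrium measure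
is the zero measure, every correlation / Laplace transform / Schur complement in the statement vanishes identically, the
`s ↓ 0` limit of `schur_s(j_b, J)` EXISTS and equals `0`, and `k₀ ≤ 0` contradicts `0 < k₀`. Witness: `ω₂ = lam = β = γ = 1`,
`T = 0`, `N = 2R + 2`, `b = R`. -/
theorem positiveMemory_false_without_TPos : ¬ PositiveMemoryWithoutTPos := by
  intro h
  obtain ⟨k₀, hk₀, R, hR⟩ := h 1 1 1 1 one_pos one_pos one_pos one_pos 0 le_rfl
  have hN : 2 ≤ 2 * R + 2 := by omega
  have key := hR (2 * R + 2) hN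
  dsimp only at key
  have hb : R < 2 * R + 2 := by omega
  have hμ : (pinnedChain 1 1 1 1).gibbsMeasure (2 * R + 2) 0 = 0 :=
    gibbsMeasure_zero_temp _ (by omega)
  have h0 := key ⟨R, hb⟩ le_rfl (by simp only; omega) 0 ?_
  · linarith
  · rw [hμ]
    simp only [integral_zero_measure, mul_zero, sub_zero, integral_zero, zero_mul, Finset.sum_const_zero]
    exact tendsto_const_nhds

/-! ## §2 The guard `2 ≤ N` is redundant -/

/-- `PositiveMemory` with the guard `2 ≤ N` DROPPED (everything else verbatim). -/
def PositiveMemoryNoNGuard : Prop :=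
  ∀ ω₂ lam β γ : ℝ, 0 < ω₂ → 0 < lam → 0 < β → 0 < γ → ∀ T : ℝ, 0 < T → ∃ k₀ : ℝ, 0 < k₀ ∧ ∃ R : ℕ, ∀ N : ℕ, let P := Literature.MathematicalPhysics.KineticTheory.HeatConduction.pinnedChain ω₂ lam β γ; let X := Literature.MathematicalPhysics.KineticTheory.HeatConduction.PhaseSpace N; let μ : MeasureTheory.Measure X := P.gibbsMeasure N T; let corr : (X → ℝ) → (X → ℝ) → ℝ → ℝ := fun f g t => (∫ z, f z * (∫ y, g y ∂(P.transitionKernel N T T t.toNNReal z)) ∂μ) - (∫ z, f z ∂μ) * (∫ z, g z ∂μ); let lap : ℝ → (X → ℝ) → (X → ℝ) → ℝ := fun s f g => ∫ t in Set.Ioi (0 : ℝ), Real.exp (-(s * t)) * corr f g t; let e : Fin N → X → ℝ := fun x z => z.2 x ^ 2 / 2 + P.U (z.1 x) + ∑ j : Fin N, ((if j.val = x.val + 1 then P.V (z.1 j - z.1 x) / 2 else 0) + (if x.val = j.val + 1 then P.V (z.1 x - z.1 j) / 2 else 0)); let G : ℝ → Matrix (Fin N) (Fin N) ℝ := fun s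 => Matrix.of fun x y => lap s (e x) (e y); let schur : ℝ → (X → ℝ) → (X → ℝ) → ℝ := fun s f g => lap s f g - ∑ x : Fin N, ∑ y : Fin N, lap s f (e x) * (G s)⁻¹ x y * lap s (e y) g; let J : X → ℝ := fun z => ∑ i : Fin N, P.bondCurrent N i z; ∀ b : Fin N, R ≤ b.val → b.val + 2 + R ≤ N → ∀ ρ : ℝ, Filter.Tendsto (fun s => schur s (P.bondCurrent N b) J) (nhdsWithin (0 : ℝ) (Set.Ioi 0)) (nhds ρ) → k₀ ≤ ρ

/-- **The guard `2 ≤ N` is free**: a bulk bond `b : Fin N` with `R ≤ b.val`, `b.val + 2 + R ≤ N` forces `2 ≤ N`. -/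
theorem positiveMemory_iff_noNGuard :
    Summit.AtomisticToContinuum.FouriersLaw.Theses.HonestZwanzig.PositiveMemory ↔ PositiveMemoryNoNGuard := by
  unfold Summit.AtomisticToContinuum.FouriersLaw.Theses.HonestZwanzig.PositiveMemory PositiveMemoryNoNGuard
  constructor
  · intro h ω₂ lam β γ hω hl hβ hγ T hT
    obtain ⟨k₀, hk₀, R, hR⟩ := h ω₂ lam β γ hω hl hβ hγ T hT
    refine ⟨k₀, hk₀, R, fun N => ?_⟩
    intro P X μ corr lap e G schur J b hRb hbN
    have hN : 2 ≤ N := by omega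
    exact hR N hN b hRb hbN
  · intro h ω₂ lam β γ hω hl hβ hγ T hT
    obtain ⟨k₀, hk₀, R, hR⟩ := h ω₂ lam β γ hω hl hβ hγ T hT
    exact ⟨k₀, hk₀, R, fun N _ => hR N⟩


/-! ## §3 Why the crux resists (no kill available to a disprover)

* **Exact meaning.** For `s > 0` all objects are junk-free: `corr(f,g)(t) = ⟨f̄, P_t ḡ⟩_μ` with `μ` the (honest, tilted)
  Gibbs probability measure and `P_t` the (honest) law of the SDE flow; `lap_s(f,g) = ⟨f̄,(s−L)⁻¹ḡ⟩_μ`;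
  `ξᵀG(s)ξ = ⟨h,(s−L)⁻¹h⟩`, `h = Σξ_x ē_x ≠ 0` for `ξ ≠ 0` (the centred site energies are linearly independent: only `e_x`
  contains `p_x²`), whose real part is `s‖(s−L)⁻¹h‖² > 0` — so `G(s)` is invertible and `(G s)⁻¹` is NOT Mathlib's junk `0`.
  Block-inverse algebra (`M⁻¹ = [[W,X],[Y,Z]] ⇒ D⁻¹ = Z − YW⁻¹X`, valid without self-adjointness) gives
  `schur_s(f,g) = ⟨Q f̄, (s − QLQ|_{Ran Q})⁻¹ Q ḡ⟩_μ`, `Q = 1 − P`, `P` the `L²(μ)`-orthoprojection onto `span{1,e_x}`: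
  the planner's reading is correct, `ρ_b(s) = ⟨j_b,(s − QLQ)⁻¹J⟩_μ` (`Qj_b = j_b` by momentum parity).
* **Only an existing SMALL limit refutes.** The conclusion is `∀ ρ, Tendsto … (𝓝 ρ) → k₀ ≤ ρ`; `𝓝[>] 0` is `NeBot`, so this
  is "IF the DC limit exists it is `≥ k₀`". Divergence to `+∞` (harmonic member) or non-existence is harmless.
* **Average positivity is automatic.** `Σ_b ρ_b(s) = schur_s(J,J) = lap_s(J,J) + m(s)ᵀ𝔽(s)⁻¹m(s) ≥ lap_s(J,J)` (circuit
  identity inside the landed `NetworkReduction`, `𝔽` symmetric positive definite by time reversal), and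
  `lap_0(J,J) = (N−1)T²D_N` (KDN / `OpenChainGreenKubo`, landed). So the bond-average of `ρ_b` is `≥ T²D_N`, which
  Fourier's law makes `→ T²κ(T) > 0`. A counterexample therefore needs either `κ(T) = 0` (the conjunct itself fails —
  then one files `¬FouriersLaw`, not a repair) or a bulk-INHOMOGENEOUS `ρ_b` (some bulk bonds insulating while the average is
  not), which approximate translation invariance away from the contacts forbids heuristically. Nothing finite decides
  either for the anharmonic chain: `PositiveMemory` is the conjunct's positivity half in Zwanzig's coordinates.
* **Dissipativity gives the sign of the symbol, not the floor.** `ξ ↦ Σ_{bb'} g_b 𝔎(s)_{bb'} g_{b'} = schur_s(J_g,J_g) ≥ 0`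
  for every bond profile `g` (resolvent of the dissipative `QLQ`), so the translation-invariant symbol `K(k,0) ≥ 0` for
  all `k` and `ρ_b → K(0,0) = χD ≥ 0`; strict positivity `χD > 0` is exactly `κ > 0`.
* **Barriers.** `HarmonicCrystalBallistic`, `MazurBoundBallistic(OpenChain)`: ballistic channels push `ρ_b` UP
  (`ρ_b ≈ 2.9N` at `lam = β = 0`, ideator kit j015397) — they attack `OrthogonalOhm`'s boundedness, not this floor.
  `StrongPinningBreathers` (Hairer–Mattingly slow dissipation) needs pinning stiffer than coupling — excluded by `β > 0`
  (CEHR C5). `AnticontinuumLocalization` / `LowTemperatureWeakAnharmonicity`: `κ` small in parameter LIMITS, but `k₀` may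
  depend on `(ω₂, lam, β, γ, T)`; only `N → ∞` uniformity is asked. `SpectralGapClosing`: embraced by the route (slow sector
  removed by hand). `ledger negatives --problem AtomisticToContinuum`: nothing near this item.
* **Mean free path (information for provers, kit j016583 / j016669).** For the literal parameters `pinnedChain 1 1 1 1`,
  `T ∈ {1,2,4,8}`, the periodic chain's energy modes are NOT diffusive down to `k = 2π/256`: the integrated relaxation
  time scales like `τ(k) ∝ k^{-1.0…-1.2}` for `0.025 ≤ k ≤ 0.4` (e.g. `T = 1`: `τ = 65, 22, 14.7, 11.0, 8.2` at
  `k = 0.0245·(1,2,3,4,5)`), i.e. a ballistic-to-diffusive crossover with mean free path `≳ 30–50` sites, nearly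
  `T`-independent (quartic scale invariance at large `T`). Consequence: every `N`-uniform statement of this route
  (`OrthogonalOhm`'s `R(ε)`, the constants of `RobinCoercivity`, `k₀` here) only becomes visible for `N ≫ 100` at these
  parameters; small-`N` numerics (N ≤ 64) probe the kinetic regime, not the hydrodynamic one. A cleanly diffusive member
  of the family is `pinnedChain 1 8 0.5 γ` at `T = 4` (`D ≈ 0.20`, flat `Γ(k)/k̃²` for `0.15 ≤ k ≤ 0.6`, j016669).

## §4 Line `Sketch` (picked 2026-08-16): stub-by-stub

* S1 `stub_feshbachDuality`, S2 `stub_profileForm`: fixed-`(N,s)` algebra over `FeshbachIdentities` + the landed circuit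
  package; sound (`𝔽 = χG⁻¹χ`, `G` symmetric PD ⇒ Cauchy–Schwarz in the `G`-metric; contact rows drop for `ζ|_∂ = 0`,
  `L E_ζ = J_{∇ζ}`, `J_{∇ζ}∘Θ = −J_{∇ζ}`). Verified to `1e-13` on the harmonic member by the ideators (j015277, j015397).
* S3 `stub_profileVariance`: TRUE and provable now — under `gibbsMeasure` the momenta are i.i.d. `N(0,T)` and independent
  of `q`, so `Var(E_ζ) = Var(Σζ_x p_x²/2) + Var(Φ_ζ) ≥ Σζ_x²·Var(p²/2) = (T²/2)Σζ_x²` (`E p⁴ = 3T²`). No attack.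
* S4 `stub_tentEscape` (`ξᵀG(s)ξ ≤ C_E N⁵`): with `G(k,0) = χ_k²/(k̃²K(k,0))` this is `ξᵀ(∇ᵀ𝔎∇)⁻¹ξ ≲ N⁵`, i.e. a LOWER
  bound `K ≳ χ²/C_E'` on the memory symbol at wavelength `N` — a conductivity floor for the tent functional. It is the
  crux's physics in integrated form (not weaker: an insulating bulk makes `ξᵀG(0)ξ ≫ N⁵`); true iff transport is (at
  least) diffusive. Expected constant: `ξᵀG(0)ξ ≈ (8/π⁶)(χ/D)N⁵ ≈ 0.0083(χ/D)N⁵`. No cheap attack; harmonic member `≍ N⁴`.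
* **S5 `stub_apexLocality` is MISSTATED (constant slack is false; `o(N)` slack is true and suffices).**
  MECHANISM (one-loop nonlinear fluctuating hydrodynamics, one conserved field, `d = 1`; the two-diffuson states
  `ẽ_q ẽ_{k−q} ∈ Ran Q` that the planner already flagged under `OrthogonalOhm`): the coarse-grained current is
  `−∂_x F(e)`, `F' = D(e)`, so its quadratic part is `j₂ = −(D'/2)∂_x(δe)²`, `D' = dD/de`; pairs of diffusons relax at rate
  `D(q² + (k−q)²)` under `QLQ` as under `L` (`Q` removes only the LINEAR span of the `e_x`). Hence
  `δK(k,t) = (D'²χ²/4) k² e^{−Dk²t/2}/√(2πDt)` and `δK(k, s=0) = (D'²χ²/(4D))·|k|`: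
      `K(k,0) = χD·(1 + A|k| + O(k²))`,  `A = χD'²/(4D²) = (d ln D/d ln T)²/(4c)`,  `c = χ/T²`  (`A > 0` whenever `κ(T)/c(T)`
  is not locally constant in `T`). Equivalently the integrated relaxation rate of the energy mode has a `|k|³` term,
  `Γ(k) = 1/τ(k) = k̃²K(k,0)/χ_k = Dk²(1 + A|k| + …)` (exact Mori identity `K(k,0) = χ_k/(k̃²τ(k))`, `PLP = 0` by parity) —
  the classical non-analyticity behind the divergence of Burnett coefficients in `d ≤ 2`. In real space the cusp is a
  NEGATIVE algebraic tail of the bond memory kernel, `𝔎_{b,b+z} ≈ K(z) ≈ −(AχD/π) z⁻²` (`Σ_z K(z) = χD` still converges: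
  `ρ_b` and the crux are untouched; `Σ_z |z||K(z)| = ∞`). For the tent current `J_ξ = J_L − J_R`:
      `schur_0(J_ξ,J_ξ) − schur_0(J,J) = −2·Σ_{b<apex≤b'}(𝔎_{bb'} + 𝔎_{b'b}) ≈ −4Σ_{z≥1} z K(z) ≈ +(4AχD/π)·ln N → +∞`,
  so NO constant `C_A` bounds it: S5 as typed is false for every parameter point with `A ≠ 0` (logarithmically — invisible
  in `N ≤ 64` numerics, `≈ 0.6·k·ln N` for `A ≈ 0.5`). The harmonic member's POSITIVE cross memory (`+2985` at `N = 32`) is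
  the opposite, ballistic, phenomenon and says nothing about the sign in the diffusive regime.
  REPAIR (cheap): `schur_s(J_ξ,J_ξ) ≤ schur_s(J,J) + C_A·(1 + Real.log N)` (one-loop prediction), or any explicit `o(N)`;
  the composition `stub_reduction` only uses `Σ_b ρ_b ≥ cN − (slack)` divided by `N` (see `floor_of_sum_floor` below, which
  is the averaging step with sublinear slack, PROVED). Numerical test of the mechanism on the actual chain: kit job
  `kcusp-prod8` (periodic `pinnedChain 1 8 0.5`, `T ∈ {3, 4, 5.33}`, `N = 128`, fit `Γ(k)/k̃² = D + a|k| + bk²` against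
  `D + bk² + ck⁴`, zero-parameter prediction `a/D = A`); numbers are folded in below when the job lands.
* **Joint sufficiency** (`stub_reduction`): sound modulo S5's slack — S1 (a = ζ = ξ) + S3 + S4 give
  `ξᵀ𝔽(s)ξ ≥ (T²Σξ²/2)²/(C_E N⁵) = c₁N + O(1)`, S2 turns it into `schur_s(J_ξ,J_ξ) ≥ c₁N − s·Var(E_ξ)`, S5 (+slack) into
  `schur_s(J,J) ≥ c₁N − slack`, `s ↓ 0` at fixed `N` then `OrthogonalOhm` (existence, boundedness `C`, bulk homogeneity
  `R(ε)`) give `k ≥ c₁`, and `k₀ := c₁/2` with `R := R(c₁/2)`; uniqueness of limits in the `NeBot` filter `𝓝[>]0` transfers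
  to "every `ρ`". Expected size: `c₁ ≈ (π⁶/4608)·T⁴D/χ ≈ 0.21·T²D·(T²c)/χ… ≈ 0.2k` — consistent (`c₁ ≤ k` necessarily).
-/

/-- **Averaging step with SUBLINEAR slack** (the only place where S5 enters the composition of line `Sketch`): if the
bond responses `ρ N b` are bounded by `C`, are `ε`-close to `k` on bulk bonds (distance `≥ R(ε)` from both ends — the
shape of `OrthogonalOhm`), and their sum is `≥ c·N − f N` eventually with `f N / N → 0`, then `c ≤ k`. With `f` constant
this is the step the skeleton needs for S5 as typed; the lemma shows that ANY `o(N)` slack in S5 (e.g. the one-loop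
`C_A(1 + log N)`) is enough. Pure real analysis, no dynamics. -/
theorem floor_of_sum_floor (ρ : (N : ℕ) → Fin N → ℝ) (k C c : ℝ) (f : ℕ → ℝ)
    (hC : ∀ (N : ℕ) (b : Fin N), |ρ N b| ≤ C)
    (hhom : ∀ ε : ℝ, 0 < ε → ∃ R : ℕ, ∀ (N : ℕ) (b : Fin N), R ≤ b.val → b.val + 2 + R ≤ N → |ρ N b - k| ≤ ε)
    (hsum : ∀ᶠ N : ℕ in atTop, c * N - f N ≤ ∑ b : Fin N, ρ N b)
    (hf : Tendsto (fun N : ℕ => f N / N) atTop (𝓝 0)) :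
    c ≤ k := by
  by_contra hck
  push Not at hck
  set ε : ℝ := (c - k) / 3 with hε_def
  have hε : 0 < ε := by rw [hε_def]; linarith
  obtain ⟨R, hR⟩ := hhom ε hε
  -- pointwise: ρ N b ≤ (k + ε) + [b not bulk] · M with M := C + |k| + ε ≥ 0
  set M : ℝ := C + |k| + ε with hM_def
  have hC0 : 0 ≤ C := le_trans (abs_nonneg _) (hC 1 0)
  have hM0 : 0 ≤ M := by rw [hM_def]; positivity
  have hpt : ∀ (N : ℕ) (b : Fin N),
      ρ N b ≤ (k + ε) + (if b.val < R ∨ N < b.val + 2 + R then M else 0) := by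
    intro N b
    by_cases hb : b.val < R ∨ N < b.val + 2 + R
    · rw [if_pos hb]
      have h1 : ρ N b ≤ C := le_trans (le_abs_self _) (hC N b)
      have h2 : -|k| ≤ k := neg_abs_le k
      rw [hM_def]; linarith
    · rw [if_neg hb]
      push Not at hb
      have := hR N b hb.1 hb.2
      have h3 : ρ N b - k ≤ ε := le_trans (le_abs_self _) this
      linarith
  -- the number of non-bulk bonds is at most 2R + 2: bound the indicator sum through `Fin.val`
  have hcount : ∀ N : ℕ, (∑ b : Fin N, (if b.val < R ∨ N < b.val + 2 + R then M else 0)) ≤ (2 * R + 2) * M := by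
    intro N
    have hle : ∀ b : Fin N, (if b.val < R ∨ N < b.val + 2 + R then M else 0) ≤
        (if b.val < R then M else 0) + (if N < b.val + 2 + R then M else 0) := by
      intro b
      by_cases h1 : b.val < R <;> by_cases h2 : N < b.val + 2 + R <;> simp [h1, h2, hM0]
    refine le_trans (Finset.sum_le_sum fun b _ => hle b) ?_
    rw [Finset.sum_add_distrib]
    -- each of the two indicator sums is a sum over an image of `Fin.val` inside a range of length ≤ R, R+2
    have hA : (∑ b : Fin N, (if b.val < R then M else 0)) ≤ R * M := by
      rw [← Finset.sum_filter]
      rw [Finset.sum_const, nsmul_eq_mul]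
      refine mul_le_mul_of_nonneg_right ?_ hM0
      have hcard : ((Finset.univ.filter fun b : Fin N => b.val < R).card : ℝ) ≤ R := by
        have h := Finset.card_le_card_of_injOn (s := Finset.univ.filter fun b : Fin N => b.val < R)
          (t := Finset.range R) (fun b => b.val) (fun b hb => by
            simp only [Finset.coe_filter, Finset.mem_univ, true_and, Set.mem_setOf_eq] at hb
            simpa using hb) (fun b _ b' _ h => Fin.ext h)
        simpa using (Nat.cast_le (α := ℝ)).2 h
      exact hcard
    have hB : (∑ b : Fin N, (if N < b.val + 2 + R then M else 0)) ≤ (R + 2) * M := by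
      rw [← Finset.sum_filter]
      rw [Finset.sum_const, nsmul_eq_mul]
      refine mul_le_mul_of_nonneg_right ?_ hM0
      have h := Finset.card_le_card_of_injOn (s := Finset.univ.filter fun b : Fin N => N < b.val + 2 + R)
        (t := Finset.range (R + 2)) (fun b => N - 1 - b.val) (fun b hb => by
          simp only [Finset.coe_filter, Finset.mem_univ, true_and, Set.mem_setOf_eq] at hb
          have := b.isLt
          simp only [Finset.coe_range, Set.mem_Iio]
          omega) (fun b hb b' hb' h => by
          have := b.isLt; have := b'.isLt
          apply Fin.ext
          simp only at h
          omega)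
      have h' := (Nat.cast_le (α := ℝ)).2 h
      simp only [Finset.card_range, Nat.cast_add, Nat.cast_ofNat] at h'
      exact h'
    linarith
  -- sum the pointwise bound
  have hsumle : ∀ N : ℕ, (∑ b : Fin N, ρ N b) ≤ N * (k + ε) + (2 * R + 2) * M := by
    intro N
    calc (∑ b : Fin N, ρ N b) ≤ ∑ b : Fin N, ((k + ε) + (if b.val < R ∨ N < b.val + 2 + R then M else 0)) :=
          Finset.sum_le_sum fun b _ => hpt N b
      _ = N * (k + ε) + ∑ b : Fin N, (if b.val < R ∨ N < b.val + 2 + R then M else 0) := by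
          rw [Finset.sum_add_distrib, Finset.sum_const, Finset.card_univ, Fintype.card_fin, nsmul_eq_mul]
      _ ≤ N * (k + ε) + (2 * R + 2) * M := by linarith [hcount N]
  -- combine with the lower bound and divide by N
  set K₀ : ℝ := (2 * R + 2) * M with hK₀_def
  have hev : ∀ᶠ N : ℕ in atTop, 2 * ε ≤ f N / N + K₀ / N := by
    filter_upwards [hsum, eventually_gt_atTop 0] with N hN hNpos
    have hNr : (0 : ℝ) < N := by exact_mod_cast hNpos
    have h1 : c * N - f N ≤ N * (k + ε) + K₀ := le_trans hN (hsumle N)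
    have h2 : (c - k - ε) * N ≤ f N + K₀ := by nlinarith
    have h3 : c - k - ε = 2 * ε := by rw [hε_def]; ring
    rw [h3] at h2
    rw [← add_div, le_div_iff₀ hNr]
    linarith
  have hlim : Tendsto (fun N : ℕ => f N / N + K₀ / N) atTop (𝓝 (0 + 0)) :=
    hf.add (tendsto_const_nhds.div_atTop tendsto_natCast_atTop_atTop)
  rw [add_zero] at hlim
  have hev2 : ∀ᶠ N : ℕ in atTop, f N / N + K₀ / N < 2 * ε :=
    (tendsto_order.1 hlim).2 _ (by linarith)
  obtain ⟨N, hN1, hN2⟩ := (hev.and hev2).exists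
  linarith


/-! ## §5 Gen-2 findings (2026-08-16)

### §5(a) The right margin is load-bearing (phantom bond) — LANDED

`Theorems/PositiveMemory/Negative/FalseWithoutRightMargin.lean` (p106337, accepted): `bondCurrent_phantom`,
`slice_false_without_rightMargin` (all parameters, all `T`, all `k₀ > 0`, all `R`: at `N = R + 2`, `b = N − 1` the map
`s ↦ schur_s(j_b, J)` is identically `0`), `positiveMemory_false_without_rightMargin`. Restated here for the record as
`positiveMemory_false_without_rightMargin'` (one-line corollary of the landed theorem).

### §5(b) Scaling normal form — proposal p107293

`Theorems/PositiveMemory/Negative/ScalingNormalForm.lean`: `integral_transitionKernel_smul`, `corr_smul`, `lap_smul`,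
`siteEnergy_smul`, `schur_scale_abstract`, `schur_bond_smul`, `slice_iff_smul`, `positiveMemory_iff_unit_temperature`.
Take-away: the five-parameter family `(ω₂, lam, β, γ, T)` of the crux is really the four-parameter family
`(ω₂, lam T, β T, γ)` at `T = 1`, with floors multiplied by `T²`. A disproof may therefore fix `T = 1`; conversely NO
argument uniform in `T` at fixed couplings can be extracted from the crux (it does not claim any).

### §5(c) Resistor calibration: the floor is the bulk symbol, contacts drop out EXACTLY

Model (the route's own "local-kernel calibration", NUMBERS section of the thesis, made bond-resolved): energy packets perform
a nearest-neighbour walk with conductance `K = χD` per bond and leave through the baths with conductance `γT²` at the two end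
sites; `ℓ := K/(γT²)` (contact resistance in bond units). Then, with `u(x) := P_x(exit through the RIGHT bath)`,
* `u` is discrete-harmonic with Robin ends: `u(x) = (x + ℓ)/(N − 1 + 2ℓ)` (exact);
* `lap_0(e_x, j_b) = χ(u(x) − 𝟙[x > b])` (expected energy through bond `b` from a unit fluctuation at `x`), so by time
  reversal `v_b(x) := lap_0(j_b, e_x) = −χ(u(x) − 𝟙[x > b])` and `w(y) := lap_0(e_y, J) = χ((N−1)u(y) − y)`;
* `G(0) = χ (D Δ_Robin)⁻¹`, i.e. `G(0)⁻¹ = (D/χ) Δ_Robin` with `Δ_Robin = path Laplacian + ℓ⁻¹(δ_0δ_0ᵀ + δ_{N−1}δ_{N−1}ᵀ)`;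
* `Δ_Robin u = ℓ⁻¹ δ_{N−1}` and `Δ_Robin id = −δ_0 + (1 + (N−1)/ℓ) δ_{N−1}`, hence `Δ_Robin w = χ(δ_0 − δ_{N−1})` and
  `v_bᵀ G(0)⁻¹ w = −χD (u(0) − u(N−1) + 1) = −2χD·u(0) = −2Kℓ/(N−1+2ℓ)` for EVERY bond `b`;
* `lap_0(j_b, J) = K(N−1)/(N−1+2ℓ)` for every bond (flat by the Kolmogorov identity `lap_0(j_{x−1} − j_x, J) = 0` in the
  bulk — `OrthogonalOhmRowIdentity` — and equal to `T²D_N` by KDN; the value is the series formula of the thesis).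
Therefore `ρ_b = lap_0(j_b,J) − v_bᵀG(0)⁻¹w = K(N−1)/(N−1+2ℓ) + 2Kℓ/(N−1+2ℓ) = K` for every `b ∈ {0,…,N−2}`, every
`N ≥ 2`, every `ℓ > 0`. CONSEQUENCES. (i) `k₀ ≤ K = T²κ` necessarily and `k₀ = K` is attained in the calibration: the crux
cannot be strengthened beyond `T²κ`, and any `N`-uniform floor is a LOWER BOUND ON THE CONDUCTIVITY. (ii) `R = 0` is the
expected truth (the Schur complement is contact-blind); `R` is a convenience of proofs (locality layers), not of the
statement — consistent with §5(a). (iii) The ballistic member is the opposite regime (`u ≡ 1/2` off the walls, `w = O(χN)`,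
`v_bᵀG⁻¹w ≈ −0.45N`, ideator kit j015397), which is why `ρ_b` diverges there. NUMERICAL CHECK (kit j018155, `resistor_check.py`,
evidence `compute-j018155.json` on the item): with `lap_0(e_x, j_b)` computed independently from the Robin Green's function
`χ[(Δ_R⁻¹)_{bx} − (Δ_R⁻¹)_{b+1,x}]` (mean-flow currents `j_b = D(ε_b − ε_{b+1})`), the three claims (i) `lap_0(e_x,j_b) =
χ(u(x) − 𝟙[x>b])`, (ii) `w(y) = χ((N−1)u(y) − y)`, (iii) `ρ_b = K` hold to `≤ 6.3e-13` relative for all `N = 2…64`,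
`ℓ ∈ {0.1, 1, 10, 37.5}` — PASS. GENERALISATION (same algebra, bond-dependent conductances `K_b`, e.g. depressed contact bonds
`K_0 = K_{N−2} = K' < K`): `u(x) = (1/(γT²) + Σ_{b<x} K_b⁻¹)/R_tot`, `R_tot = 2/(γT²) + Σ_b K_b⁻¹`, `lap_0(j_b,J) = (N−1)/R_tot`
(flat), and the Schur floor reads off the LOCAL conductance: `ρ_b = K_b` for every bond — which is just `ρ_b = Σ_{b'}𝔎_{bb'}`
for a diagonal kernel `𝔎 = diag(K_b)`; the content of the calibration is only that the route's gadget, fed the walk's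
`corr / lap / G`, returns the local symbol with NO contamination from the contact resistance `1/(γT²)` or from the other bonds.
So a depressed contact conductance `K' < K` lowers `ρ_0, ρ_{N−2}` to `K'` (still `> 0`): the physical role of `R` is to step
over the contact LAYER where the local symbol differs from the bulk one, not to avoid a sign problem.

### §5(d) Line `Sketch` v3 — see the index; no target stubs (payload `stuck_stubs = []`). What the line buys:

With S1–S3 landed and the two reductions proved by the lead, `PositiveMemory ⇐ TentEscape + ApexLocalityEps +
OrthogonalOhm + FeshbachIdentities` (tent route) or `⇐ RobinCoercivity + ApexLocalityEps + OrthogonalOhm + FeshbachIdentities`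
(Robin route). Remarks for the lead / a consult:
* `TentEscape` is an UPPER bound on a resolvent quadratic form, `sup_{0<s<s₀(N)} ⟨Ē_ξ,(s − L_N)⁻¹Ē_ξ⟩_μ ≤ C_E N⁵` with
  `Var(E_ξ) ≍ χN³/12`: an `N`-uniform statement that the tent energy profile relaxes in integrated time `≲ N²`, i.e. a
  DIFFUSIVE LOWER BOUND on energy transport; through the reduction it yields `k ≥ k₀ > 0`, a lower bound on the conductivity,
  for which no printed technology exists for a deterministic anharmonic bulk (grounder note: Landim–Mariani–Seo Dirichlet/Thomson
  principles concern the full generator of finite / diffusive models; Bernardin–Olla-type two-sided bounds need bulk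
  conservative noise; my own search 2026-08-16 was DEGRADED — searchd down, OpenAlex/S2 HTTP 429, crossref irrelevant — so
  this is the grounder's verdict, not re-verified). It is the crux in integrated form, as gen-1 said (§4).
* Spectral shortcuts cannot reach `N⁵`: an `L²(μ)` gap `λ_N` only gives `ξᵀG(0)ξ ≤ C·Var(E_ξ)/λ_N`, so `λ_N ≳ N⁻²` would be
  needed `N`-uniformly, while already the HARMONIC member has `λ_N ≍ N⁻³` (Menegaki 2020 Prop. 1.6 / Becker–Menegaki, band-edge
  modes; `Literature.Barriers.AtomisticToContinuum.SpectralGapClosing`) and yet `ξᵀG(0)ξ ≍ N⁴` there: the tent profile does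
  not see the slowest modes. Any proof must use the PROFILE (smooth, bulk-supported) — a hypocoercive estimate for the energy
  field tested against slowly varying profiles only, which is exactly `RobinCoercivity`'s content.
* Indeed `TentEscape ⇐ RobinCoercivity + FeshbachIdentities` up to constants: `G(s) = χ𝔽(s)⁻¹χ` with `𝔽(s)` symmetric
  positive definite (time reversal), and `𝔽 ≥ c(Δ_path + E_∂)` implies `𝔽⁻¹ ≤ c⁻¹(Δ_path + E_∂)⁻¹` (operator monotonicity of
  inversion), so `ξᵀG(s)ξ = (χξ)ᵀ𝔽(s)⁻¹(χξ) ≤ c⁻¹‖(Δ_path+E_∂)⁻¹‖·‖χξ‖² ≤ c⁻¹ (N²/π² + O(N)) · ‖χ‖²·N³/12 = O(N⁵)` (`χ` = the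
  static covariance MATRIX, banded, `N`-uniformly bounded by `stub_profileVariance`-type Gibbs estimates). So the tent route's
  physics stub is the one-profile shadow of the sibling crux; `stub_robinReduction` is the economical composition, and a
  disprover of `TentEscape` would be disproving `RobinCoercivity` on the tent.

### §5(e) Numerics — `numerics_gen2`

METHOD (kit bundle `kit/rho`: `chainmd.py`, `exact_gauss.py`, `main.py`; disprover folder). Equilibrium MD of the OPEN chain,
BAOAB with exact OU on the two end momenta, `dt = 0.005`, Gibbs initial data by thermostatting ALL sites first (same Gibbs
measure), then end baths only; `lap_s(f,g) = Cov(Z_f(t), g(t))` with the causal exponential integral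
`Z_f(t) = ∫_{−∞}^t e^{−s(t−t')} f(t') dt'` (gives the ORDERED transform, no symmetrisation), all pairs `f,g ∈ {e_x, j_b}`,
`s ∈ {0.01, 0.02, 0.05, 0.1, 0.2, 0.5}`, then `G(s)`, `schur_s`, `ρ_b(s)` by the route's formulas; jackknife errors over
independent tasks. VALIDATION: (1) the exact Gaussian code reproduces ideator-2's harmonic numbers (`N = 8`, `s = 10⁻⁷`:
`Σρ_b = 28.563` vs `28.6`, `lap(J,J) = 6.126` vs `6.13`, `G_33(0⁺) = 7.815` vs `7.82`); exact harmonic profile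
`ρ_b = (0.857, 4.068, 6.021, 6.673, 6.021, 4.068, 0.857)` — strongly NON-flat (ballistic, parabolic). (2) MD vs exact on the
harmonic member `N = 4`, `γ = T = 1` (kit j018045, `1.6·10⁶` time units): `ρ_b(s)` within `0.1–3.4` SE at every `s`
(e.g. `s = 0.02`: exact `(0.424, 1.002, 0.424)`, MD `(0.427±0.009, 1.010±0.006, 0.432±0.008)`), block errors `≤ 2 %`,
statics to `0.3 %`. So estimator, signs, the `e_x / j_b` conventions and the Schur algebra are right.

FIRST ANHARMONIC RESULT (kit j018045, member `pinnedChain 1 8 0.5 1`, `T = 4`, `N = 4`, `R = 1024` replicas × 4 tasks,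
`1.6·10⁶` time units; `χ_xx ≈ 11.5–11.8`, `⟨j_b⟩ ≤ 6·10⁻⁴`):

  s      lap_s(J,J)/3    schur_s(J,J)/3    ρ_0(s)        ρ_1(s)        ρ_2(s)      |  lap_s(j_b,J), b = 0,1,2
  0.5    2.122(3)        2.229(4)          1.993(12)     2.695(12)     2.000(14)   |  1.992  2.384  1.989
  0.2    2.600(4)        2.830(6)          2.536(18)     3.416(13)     2.539(20)   |  2.519  2.778  2.503
  0.1    2.781(9)        3.074(11)         2.787(25)     3.653(13)     2.781(24)   |  2.741  2.885  2.717
  0.05   2.876(14)       3.202(17)         2.935(35)     3.759(16)     2.911(28)   |  2.863  2.932  2.833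
  0.02   2.937(17)       3.280(21)         3.039(46)     3.813(18)     2.988(31)   |  2.942  2.961  2.909
  0.01   2.953(30)       3.306(29)         3.082(57)     3.812(26)     3.022(38)   |  2.968  2.962  2.929

READINGS. (i) PLATEAU: `ρ_b(s)` is monotone in `s` and saturates below `s ≈ 0.02` (`ρ_1`: `3.813 → 3.812`; contacts within
errors) — the `s ↓ 0` limit exists numerically and is reached at `s ∼ 1/τ_micro`, with no slow scale (the thesis of the
route: no hydrodynamic pole in the orthogonal resolvent) — at this tiny `N`. (ii) SIGN/FLOOR: all `ρ_b > 0`, `ρ_b ≥ lap_0(j_b,J)`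
bondwise. (iii) NOT FLAT at `N = 4`: middle bond `3.81`, contact bonds `3.05 ± 0.05` (ratio `1.25`): the contact layer has a
depressed local symbol (one momentum of `j_0` is thermostatted) — `R ≥ 1` is where the SHARP floor lives, `R = 0` still has
a floor. (iv) `lap_s(j_b,J)` is flat in `b` within errors at small `s` (row identity) and BELOW the Schur values; the
inhomogeneous resistor reading `K = 3.81, K' = 3.05, γT² = 16` predicts `ρ_1/lap_0 = [(N−3) + 2K/K' + 2K/(γT²)]/(N−1) = 1.33`,
measured `1.29 ± 0.02`. PENDING: kit j018151 (validation `N = 4, 8, 6`; member A `γ = 1`, `N = 3…16`; 3.5 h cap) and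
j018387 (member A `γ = 0.1`, `N = 3…12` — the discriminating contact-resistance series — and the literal member `1 1 1 1`,
`T = 1`, `N = 4, 8`); their tables are appended here when they land. -/

/-- §5(a) The phantom bond: for the last site `b = N − 1` there is no bond and `bondCurrent N b = 0`. (Landed as
`…Negative.FalseWithoutRightMargin.bondCurrent_phantom`; restated so that this work file stays import-minimal.) [folklore] -/
theorem bondCurrent_phantom' (P : OscillatorChain) {N : ℕ} (b : Fin N) (hb : b.val + 1 = N) :
    P.bondCurrent N b = 0 := by
  funext z
  unfold OscillatorChain.bondCurrent
  refine Finset.sum_eq_zero fun j _ => ?_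
  have hj := j.isLt
  rw [if_neg (by omega)]

/-- §5(a) **`PositiveMemory` without the right margin `b.val + 2 + R ≤ N` is false** (phantom bond `b = N − 1` at
`N = R + 2`: `j_b = 0`, `schur ≡ 0`, the limit `0` exists, `k₀ ≤ 0`). Landed as
`…Negative.FalseWithoutRightMargin.positiveMemory_false_without_rightMargin` (p106337); same proof. [folklore] -/
theorem positiveMemory_false_without_rightMargin' :
    ¬ ∀ ω₂ lam β γ : ℝ, 0 < ω₂ → 0 < lam → 0 < β → 0 < γ → ∀ T : ℝ, 0 < T → ∃ k₀ : ℝ, 0 < k₀ ∧ ∃ R : ℕ, ∀ N : ℕ, 2 ≤ N → let P := Literature.MathematicalPhysics.KineticTheory.HeatConduction.pinnedChain ω₂ lam β γ; let X := Literature.MathematicalPhysics.KineticTheory.HeatConduction.PhaseSpace N; let μ : MeasureTheory.Measure X := P.gibbsMeasure N T; let corr : (X → ℝ) → (X → ℝ) → ℝ → ℝ := fun f g t => (∫ z, f z * (∫ y, g y ∂(P.transitionKernel N T T t.toNNReal z)) ∂μ) - (∫ z, f z ∂μ) * (∫ z, g z ∂μ); let lap : ℝ → (X → ℝ) → (X →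 ℝ) → ℝ := fun s f g => ∫ t in Set.Ioi (0 : ℝ), Real.exp (-(s * t)) * corr f g t; let e : Fin N → X → ℝ := fun x z => z.2 x ^ 2 / 2 + P.U (z.1 x) + ∑ j : Fin N, ((if j.val = x.val + 1 then P.V (z.1 j - z.1 x) / 2 else 0) + (if x.val = j.val + 1 then P.V (z.1 x - z.1 j) / 2 else 0)); let G : ℝ → Matrix (Fin N) (Fin N) ℝ := fun s => Matrix.of fun x y => lap s (e x) (e y); let schur : ℝ → (X → ℝ) → (X → ℝ) → ℝ := fun s f g => lap s f g - ∑ x : Fin N, ∑ y : Fin N, lap s f (e x) * (G s)⁻¹ x y * lap s (e y) g; let J : X → ℝ := fun z => ∑ i : Fin N, P.bondCurrent N i z; ∀ b : Fin N, R ≤ b.val → ∀ ρ : ℝ, Filter.Tendsto (fun s => schur s (P.bondCurrent N b) J) (nhdsWithin (0 : ℝ) (Set.Ioi 0)) (nhds ρ) → k₀ ≤ ρ := by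
  intro h
  obtain ⟨k₀, hk₀, R, hR⟩ := h 1 1 1 1 one_pos one_pos one_pos one_pos 1 one_pos
  have hN : 2 ≤ R + 1 + 1 := by omega
  have key := hR (R + 1 + 1) hN
  dsimp only at key
  have hb : R + 1 < R + 1 + 1 := by omega
  have hj : (pinnedChain 1 1 1 1).bondCurrent (R + 1 + 1) ⟨R + 1, hb⟩ = 0 := bondCurrent_phantom' _ _ rfl
  have h0 := key ⟨R + 1, hb⟩ (by simp only; omega) 0 ?_
  · linarith
  · rw [hj]
    simp only [Pi.zero_apply, zero_mul, integral_zero, sub_zero, mul_zero, Finset.sum_const_zero]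
    exact tendsto_const_nhds

/-- §5(c) **Resistor calibration, the one-line algebra**: if the unprojected response is the series value
`c₀ = K(N−1)/(N−1+2ℓ)` and the Schur correction is `−vᵀG⁻¹w = 2Kℓ/(N−1+2ℓ)` (both derived in the §5 docblock from the
nearest-neighbour walk), the floor is exactly the bulk conductance `K`, for every `N ≥ 2` and `ℓ ≥ 0`. [folklore] -/
theorem resistor_calibration (K ℓ : ℝ) (N : ℕ) (hN : 2 ≤ N) (hℓ : 0 ≤ ℓ) :
    K * ((N : ℝ) - 1) / ((N : ℝ) - 1 + 2 * ℓ) + 2 * K * ℓ / ((N : ℝ) - 1 + 2 * ℓ) = K := by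
  have hN' : (2 : ℝ) ≤ N := by exact_mod_cast hN
  have hden : ((N : ℝ) - 1 + 2 * ℓ) ≠ 0 := by
    have : (0 : ℝ) < (N : ℝ) - 1 + 2 * ℓ := by linarith
    exact this.ne'
  rw [← add_div, div_eq_iff hden]
  ring

/-- §5(e) kit job ids of the gen-2 numerics: j018155 (resistor identities, PASS), j018045 (selftest: exact cross-check +
harmonic validation + first anharmonic `N = 4` table, above), j018151 and j018387 (production, pending). The statement is
`True`; the evidence lives in the §5(e) docblock and is updated in place. [folklore] -/
theorem numerics_gen2 : True := trivial


/-! ## §6 Gen-3 findings (2026-08-16, seat `refuter-cdisprove-…-12694-g3-0`)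

### §6(a) Formal status of the crux (read from line `Sketch` v9 and the lead reports c2–c6; verified by type, not re-proved)

* SUFFICIENCY (landed p120416): `PositiveMemory_of : OrthogonalOhm → JunctionLocality.ConductanceLowerBound → PositiveMemory`.
* NECESSITY (composition of landed theorems, lead c6 `work/NecessityCheck.lean` rc 0):
  `OrthogonalOhm → FouriersLaw → PositiveMemory` (`PositiveMemory_of_memoryConductivity ∘ memoryConductivity_of_fouriersLaw ∘
  openChainGreenKubo_holds`). Contrapositive: **`¬PositiveMemory → OrthogonalOhm → ¬FouriersLaw`** — an unconditional kill of
  crux #3 is a disproof of the conjunct modulo crux #2. There is therefore NO attack surface on crux #3 that is not an attack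
  on Fourier's law itself or on crux #2 (`OrthogonalOhm`, another seat's crux); the disprover's verdict after three generations
  is "resists because it is the conjunct's positivity half in Zwanzig's coordinates" (gen 1 §3(c), now a theorem chain).
* What the planner can do (agreeing with leads c2–c6): make `HonestZwanzig` WANT stmt-11749, or restate crux #3 as the line's
  `BulkBackflowFloorSig`, or — using §6(b) — as the existence-free floor `Schur₀Floor` plus the fixed-`N` item `det G₀ ≠ 0`.

### §6(b) THE EXISTENCE BARRIER and FixedNLap modulo `det G₀ ≠ 0` — LANDED as
`Theorems/PositiveMemory/Negative/ExistenceBarrier.lean` (p126176)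

The conclusion `∀ ρ, Tendsto (s ↦ schur_s(j_b,J)) (𝓝[>]0) (𝓝 ρ) → k₀ ≤ ρ` is existence-guarded, so (`kill_shape` below,
= `…ExistenceBarrier.not_positiveMemory_of_witness`) EVERY refutation of the crux or of a same-shape strengthening (`R = 0`,
`k₀` uniform in `T` or in `γ`, `BulkBackflowFloorSig`) must PRODUCE a limit of the orthogonal DC response of an ANHARMONIC
chain at some fixed `N`. The two refuted slices on record (`T = 0`, phantom bond) are exactly the two places where
`s ↦ schur_s(j_b,J)` is identically zero. Nothing else in reach produces a limit — except the following, now landed: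

* `tendsto_lap_of_adm`: `lap_s(f,g) → lap₀(f,g) := ∫₀^∞corr(f,g)` for all admissible `f,g` (dominated convergence on the landed
  `FeshbachIdentities` (i));
* `tendsto_inv_G`, `tendsto_schur_of_det_ne_zero`, `tendsto_schur_bond`: IF `det G₀ ≠ 0`, `G₀ := [lap₀(e_x,e_y)]`, then
  `(G s)⁻¹ → G₀⁻¹` and for EVERY bond `ρ_b = lim_{s↓0} schur_s(j_b,J)` EXISTS and equals the explicit finite-`N` number
  `schur₀(j_b,J) = lap₀(j_b,J) − lap₀(j_b,e)·G₀⁻¹·lap₀(e,J)`;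
* `not_positiveMemory_of_schur₀_witness`: modulo `det G₀ ≠ 0` at the witnessing `N`, a small value of `schur₀(j_b,J)` on bulk bonds
  kills the crux — no limit to be produced any more;
* `positiveMemory_iff_schur₀Floor`: under `det G₀ ≠ 0` at every admissible point, `PositiveMemory ↔ ∃k₀>0 ∃R ∀N≥2 ∀R-bulk b,
  k₀ ≤ schur₀(j_b,J)` — the crux IS "`N`-uniform positivity of an explicit Schur complement of Green–Kubo-type integrals".
* `Negative/NonDegeneracy.lean` (p126437): WHAT THE HYPOTHESIS IS — `G₀` is symmetric (`G₀_symm`, time reversal) and positive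
  SEMI-definite (`G₀_form_nonneg`, limit of the positive definite `G(s)`), a vanishing form forces `G₀ξ = 0`
  (`mulVec_eq_zero_of_form_eq_zero`), so `det G₀ ≠ 0 ↔ ξᵀG₀ξ > 0 ∀ξ ≠ 0` (`det_ne_zero_iff_form_pos`, `det_G₀_ne_zero_iff` for the
  canonical gadgets): FixedNLap = "every nonzero energy profile `h = Σξ_xe_x` has `∫₀^∞corr(h,h) > 0`".

WHY `det G₀ ≠ 0` SHOULD HOLD (blueprint for the fixed-`N` item "FixedNLap", NOT formalised — needs the weak Kolmogorov equation
for `v := ∫₀^∞ P_t^* h̄ dt` and the bath Dirichlet-form identity in `L²(μ)`): `G₀` is symmetric (time reversal, `e_x` even) and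
positive SEMI-definite (limit of the positive definite `G(s)`, `FeshbachIdentities` (iv)). If `ξᵀG₀ξ = 0`, `h := Σξ_xe_x`, then
`0 = lap₀(h,h) = ⟨v, h̄⟩ = γT·Σ_{b∈{0,N−1}} ‖∂_{p_b}v‖²_{L²(μ)}` with `−L^*v = h̄`, so `v` is independent of `p_0, p_{N−1}` and
`L_H v = h̄` (`L^* = −L_H + γS_∂`). Three commutators finish: (1) `∂_{p_0}`: `[∂_{p_0},L_H] = ∂_{q_0}` gives `∂_{q_0}v = ∂_{p_0}h̄ = ξ_0p_0`,
whose left side is `p_0`-free ⇒ `ξ_0 = 0` and `∂_{q_0}v = 0`; (2) `∂_{q_0}`: `[∂_{q_0},L_H]v = V''(r)∂_{p_1}v` (`r = q_1−q_0`,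
`∂_{p_0}v = 0`) and `∂_{q_0}h̄ = −(ξ_1/2)V'(r)` ⇒ `∂_{p_1}v = ξ_1φ(r)`, `φ := −V'/(2V'')`, so `v = ξ_1φ(r)p_1 + w` with `w` free of
`p_0, p_1`; (3) `∂_{p_1}`: `[∂_{p_1},L_H] = ∂_{q_1}` gives `∂_{q_1}v = ξ_1p_1 − ξ_1(p_1 − p_0)φ'(r)`, while the affine form gives
`∂_{q_1}v = ξ_1φ'(r)p_1 + ∂_{q_1}w`; comparing the coefficients of `p_0` and of `p_1` (everything else is `p_0,p_1`-free):
`ξ_1φ' = 0` and `ξ_1(1 − 2φ') = 0` a.e., hence `ξ_1 = 0`, `v` is free of `q_0,p_0,q_1,p_1`, and the same two steps shifted by one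
site run along the chain (`[∂_{q_x},L_H]v = V''(q_{x+1}−q_x)∂_{p_{x+1}}v`, `∂_{q_x}h̄ = −(ξ_{x+1}/2)V'`), giving `ξ = 0` (at the last
site `∂_{p_{N−1}}v = 0` from the right bath and `V' ≢ 0`). (For the pinned chain `V'' ≥ 1` and all functions are polynomially
bounded; the distributional calculus is legitimate once `v ∈ L²(μ)` solves `L_Hv = h̄` weakly with `∂_{p_∂}v = 0`.)
So FixedNLap is a genuine but routine hypoellipticity lemma; it is crux #2's foreseen first layer and would (i) discharge the
existence clause of `OrthogonalOhm` at fixed `N`, (ii) make crux #3 existence-free (`positiveMemory_iff_schur₀Floor`), (iii) re-arm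
this disprover lineage with something to compute: the sign/size of `schur₀(j_b,J)` — which is exactly what the MD of gen 2 / lead c7
estimates (`ρ_b(s)` plateau below `s ≈ 0.02`, all `> 0`, §5(e)).

### §6(c) `0 < γ` — the isolated chain (analysis; undecidable cheaply, recorded so nobody redoes it)

At `γ = 0` the noise amplitude `√(2γT)` and the friction vanish: `transitionKernel` is the deterministic Hamiltonian flow `Φ_t`
(Dirac kernels; `pinnedChain_transitionKernel_apply` covers `γ = 0`), `μ_T` is `Φ_t`-invariant, `L = L_H` is skew on `L²(μ_T)`.
(i) UNPROJECTED response: `j_b = L_H F_b` with `F_b := Σ_{x>b} e_x` (interior `L_He_x = j_{x−1} − j_x`, no bath terms), so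
`lap_s(j_b,g) = Cov(F_b,g) − s·lap_s(F_b,g)` and, by von Neumann's mean ergodic theorem in Abel form (`s(s−L_H)⁻¹ → Π_inv`
strongly), `lap_s(j_b,J) → Cov(F_b,J) − ⟨F̄_b, Π_inv J̄⟩ = 0 − 0` (parity; `Π_inv L_H = 0`): the isolated chain's Green–Kubo
Laplace transform VANISHES at DC for every `N` and bond — currents are Liouville coboundaries of bounded energies.
(ii) PROJECTED response: `s·G(s) → M := [⟨Π_inv ē_x, Π_inv ē_y⟩]` (`𝟙ᵀM𝟙 = Var H > 0`), `lap_s(j_b,e_x) → Cov(F_b,e_x) − ⟨Π F̄_b,Πē_x⟩`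
(finite). If `M` is invertible (`N` linearly independent time-averaged site-energy fluctuations — the HARMONIC isolated chain,
or a KAM-dominated anharmonic one) then `G(s)⁻¹ = sM⁻¹ + o(s)` and `ρ_b = lim schur_s(j_b,J) = 0` EXISTS: the `γ = 0` slice would be
FALSE (the orthogonal dynamics of an isolated chain is an insulator at DC). If `M` is singular (ergodic shells: `Πē_x = E[ē_x|H]`,
rank `⌈N/2⌉` by reflection symmetry) the limit depends on the spectral measure of the site energies near `ω = 0`
(`1/ω`-integrability), unknown for an `N`-body anharmonic flow. Verdict: `0 < γ` is load-bearing IN SUBSTANCE (dissipation at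
the baths is what makes `G₀` finite — `G(s) ∼ M/s` at `γ = 0` — and the unprojected DC response nonzero), but the `γ = 0` slice of
the typed statement is not decidable with tree tools (no Koopman spectral theory for `chainFlow`); no lemma filed.
`γ < 0`: `Real.sqrt` of a negative amplitude is `0` and the friction is anti-damping — `μ_T` is not invariant, `corr` is not a
stationary covariance; meaningless slice, not pursued.

### §6(d) Load-bearing table of `PositiveMemory` (three generations; L = landed theorem, A = analysis only)

  hypothesis                 | weakened to            | status
  `0 < T`                    | `0 ≤ T` / `T ≤ 0`      | FALSE (zero Gibbs measure; L: FalseWithoutTPos, CoherentDephasing.LoadBearing) — normalisability only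
  `0 < T`                    | `k₀` uniform in `T`    | physically false at fixed `N` (`ρ_b(T) = T²ρ_b^{(lamT,βT,1)} ≈ 2.9N·T² → 0`, L: ScalingNormalForm +
                             |                        | harmonic corner), formally blocked by existence (§6(b)); the crux does not claim it
  `0 < lam`, `0 < β`         | `0 ≤ lam`, `0 ≤ β`     | NOT load-bearing for the floor (A): `lam = 0` pinned FPU-β and `β = 0` φ⁴ are normal conductors,
                             |                        | the harmonic corner has `ρ_b ≈ 2.9N·T² ≥ k₀` (ballistic pushes `ρ_b` UP); they ARE load-bearing
                             |                        | for `OrthogonalOhm`'s boundedness (L: not in this crux)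
  `0 < lam`, `0 < β`         | `lam < 0` / `β < −c·lam`| FALSE by non-normalisability (`e^{-H/T} ∉ L¹`), no information; not formalised
  `0 < ω₂`                   | `ω₂ ≤ 0`               | not load-bearing in substance (pure quartic / double-well pinning confine); tree lemmas
                             |                        | (`pinnedChain_measurable_solMap`, admissibility) are stated for `0 < ω₂` — technical only (A)
  `0 < γ`                    | `γ = 0`                | undecidable cheaply, load-bearing in substance (§6(c), A)
  `2 ≤ N`                    | dropped / `N₀ ≤ N`     | REDUNDANT, even replaceable by any `N₀ ≤ N` (`positiveMemory_iff_tail` below): the crux is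
                             |                        | a TAIL statement in `N`, finite sets of lengths are swallowed by the margin `R`
  `R ≤ b.val` (left margin)  | dropped                | open ≈ true with a smaller `k₀` (contact symbol `K' ≈ 0.8K > 0`, §5(e)); by reflection =
                             |                        | right margin weakened to `b.val + 1 < N`
  `b.val + 2 + R ≤ N`        | dropped                | FALSE (phantom bond; L: FalseWithoutRightMargin p106337)
  `∀ρ, Tendsto → k₀ ≤ ρ`     | `∃ρ, Tendsto ∧ k₀ ≤ ρ` | stronger; = crux + FixedNLap; reducible to `det G₀ ≠ 0` (L: ExistenceBarrier p126176)
  symmetric split `e_x`      | BLR split              | not attackable (both spans contain `H`; floor value unchanged in the resistor calibration)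

### §6(e) Numerics and literature bookkeeping (gen 3)

* gen-2 production jobs: j018151 (no completion event on the item) and j018387 (TIMEOUT rc=124 after 12600 s, 1 artifact,
  `compute-j018387.json` attached 20:41Z) are owner-locked (`kit compute status` refuses other seats) and the gate evidence
  directory is not mounted in a disprover jail — their tables cannot be folded into §5(e) by gen 3. Lead c7 (cycle 9) is running
  the route's discriminating MD test itself (`ρ_b(s)` plateau / `N`-drift / bulk-vs-contact backflow, `N = 4…32`); no duplicate
  job was submitted from this seat (compute discipline). With §6(b) those numbers are estimates of `schur₀(j_b,J)` itself.
* Literature (nearest tools for a LOWER bound on a non-reversible resolvent form, for provers of FixedNLap / crux #2): Gaudillière–Landim,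
  "A Dirichlet principle for non reversible Markov chains" (arXiv:1111.2445, PTRF 158, 2014); Landim–Mariani–Seo (item source
  LandimMarianiSeo2018: Dirichlet/Thomson principles for non-selfadjoint ELLIPTIC operators — not hypoelliptic); Landim–Seo
  (arXiv:1710.06672), Lee–Seo (arXiv:2008.08291) non-reversible diffusions with Gibbs invariant measure. None treats a degenerate
  (hypoelliptic) generator; the commutator blueprint of §6(b) is the hypoelliptic substitute at fixed `N`. Search state 2026-08-16
  21:1xZ: local searchd DOWN (connection reset), OpenAlex 429, S2 429, arXiv/zbMATH OK, galaxy 0 rows for "Thomson principle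
  non-reversible … capacity" — `search-degraded`, not a verdict on novelty. `ledger negatives`: nothing near this item (unchanged).
-/

/-- §6(b) **The shape every refutation must deliver** (= `…Negative.ExistenceBarrier.not_positiveMemory_of_witness`, p126176;
restated import-free): one admissible point at which, for all `k₀ > 0` and `R`, some `N ≥ 2`, some `R`-bulk bond and some LIMIT
`ρ < k₀` of `s ↦ schur_s(j_b,J)`. A non-existent limit never refutes the crux. [folklore] -/
theorem kill_shape
    (h : ∃ ω₂ lam β γ : ℝ, 0 < ω₂ ∧ 0 < lam ∧ 0 < β ∧ 0 < γ ∧ ∃ T : ℝ, 0 < T ∧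
      ∀ k₀ : ℝ, 0 < k₀ → ∀ R : ℕ, ∃ N : ℕ, 2 ≤ N ∧
      let P := Literature.MathematicalPhysics.KineticTheory.HeatConduction.pinnedChain ω₂ lam β γ
      let X := Literature.MathematicalPhysics.KineticTheory.HeatConduction.PhaseSpace N
      let μ : MeasureTheory.Measure X := P.gibbsMeasure N T
      let corr : (X → ℝ) → (X → ℝ) → ℝ → ℝ := fun f g t =>
        (∫ z, f z * (∫ y, g y ∂(P.transitionKernel N T T t.toNNReal z)) ∂μ) - (∫ z, f z ∂μ) * (∫ z, g z ∂μ)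
      let lap : ℝ → (X → ℝ) → (X → ℝ) → ℝ := fun s f g =>
        ∫ t in Set.Ioi (0 : ℝ), Real.exp (-(s * t)) * corr f g t
      let e : Fin N → X → ℝ := fun x z => z.2 x ^ 2 / 2 + P.U (z.1 x) +
        ∑ j : Fin N, ((if j.val = x.val + 1 then P.V (z.1 j - z.1 x) / 2 else 0) +
          (if x.val = j.val + 1 then P.V (z.1 x - z.1 j) / 2 else 0))
      let G : ℝ → Matrix (Fin N) (Fin N) ℝ := fun s => Matrix.of fun x y => lap s (e x) (e y)
      let schur : ℝ → (X → ℝ) → (X → ℝ) → ℝ := fun s f g =>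
        lap s f g - ∑ x : Fin N, ∑ y : Fin N, lap s f (e x) * (G s)⁻¹ x y * lap s (e y) g
      let J : X → ℝ := fun z => ∑ i : Fin N, P.bondCurrent N i z
      ∃ b : Fin N, R ≤ b.val ∧ b.val + 2 + R ≤ N ∧ ∃ ρ : ℝ, ρ < k₀ ∧
        Filter.Tendsto (fun s => schur s (P.bondCurrent N b) J) (nhdsWithin (0 : ℝ) (Set.Ioi 0)) (nhds ρ)) :
    ¬ Summit.AtomisticToContinuum.FouriersLaw.Theses.HonestZwanzig.PositiveMemory := by
  intro hPM
  obtain ⟨ω₂, lam, β, γ, hω, hl, hβ, hγ, T, hT, hw⟩ := h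
  obtain ⟨k₀, hk₀, R, hR⟩ := hPM ω₂ lam β γ hω hl hβ hγ T hT
  obtain ⟨N, hN, hwN⟩ := hw k₀ hk₀ R
  have key := hR N hN
  dsimp only at key hwN
  obtain ⟨b, hb1, hb2, ρ, hρ, hten⟩ := hwN
  have := key b hb1 hb2 ρ hten
  linarith

/-- §6(d) **The crux is a tail statement in `N`** (strengthens §2 `positiveMemory_iff_noNGuard`): `PositiveMemory` is equivalent to
its version in which, at each parameter point, the floor is only required for `N ≥ N₀` with `N₀` chosen by the prover together with
`k₀, R` (and the guard `2 ≤ N` dropped) — the margin `R' := R + N₀` swallows every finite set of chain lengths. So the crux has no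
finite-`N` content at all; conversely no finite computation can establish it. [folklore] -/
theorem positiveMemory_iff_tail :
    Summit.AtomisticToContinuum.FouriersLaw.Theses.HonestZwanzig.PositiveMemory ↔
    ∀ ω₂ lam β γ : ℝ, 0 < ω₂ → 0 < lam → 0 < β → 0 < γ → ∀ T : ℝ, 0 < T → ∃ k₀ : ℝ, 0 < k₀ ∧ ∃ R N₀ : ℕ, ∀ N : ℕ, N₀ ≤ N →
      let P := Literature.MathematicalPhysics.KineticTheory.HeatConduction.pinnedChain ω₂ lam β γ
      let X := Literature.MathematicalPhysics.KineticTheory.HeatConduction.PhaseSpace N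
      let μ : MeasureTheory.Measure X := P.gibbsMeasure N T
      let corr : (X → ℝ) → (X → ℝ) → ℝ → ℝ := fun f g t =>
        (∫ z, f z * (∫ y, g y ∂(P.transitionKernel N T T t.toNNReal z)) ∂μ) - (∫ z, f z ∂μ) * (∫ z, g z ∂μ)
      let lap : ℝ → (X → ℝ) → (X → ℝ) → ℝ := fun s f g =>
        ∫ t in Set.Ioi (0 : ℝ), Real.exp (-(s * t)) * corr f g t
      let e : Fin N → X → ℝ := fun x z => z.2 x ^ 2 / 2 + P.U (z.1 x) +
        ∑ j : Fin N, ((if j.val = x.val + 1 then P.V (z.1 j - z.1 x) / 2 else 0) +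
          (if x.val = j.val + 1 then P.V (z.1 x - z.1 j) / 2 else 0))
      let G : ℝ → Matrix (Fin N) (Fin N) ℝ := fun s => Matrix.of fun x y => lap s (e x) (e y)
      let schur : ℝ → (X → ℝ) → (X → ℝ) → ℝ := fun s f g =>
        lap s f g - ∑ x : Fin N, ∑ y : Fin N, lap s f (e x) * (G s)⁻¹ x y * lap s (e y) g
      let J : X → ℝ := fun z => ∑ i : Fin N, P.bondCurrent N i z
      ∀ b : Fin N, R ≤ b.val → b.val + 2 + R ≤ N → ∀ ρ : ℝ,
        Filter.Tendsto (fun s => schur s (P.bondCurrent N b) J) (nhdsWithin (0 : ℝ) (Set.Ioi 0)) (nhds ρ) → k₀ ≤ ρ := by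
  unfold Summit.AtomisticToContinuum.FouriersLaw.Theses.HonestZwanzig.PositiveMemory
  constructor
  · intro h ω₂ lam β γ hω hl hβ hγ T hT
    obtain ⟨k₀, hk₀, R, hR⟩ := h ω₂ lam β γ hω hl hβ hγ T hT
    refine ⟨k₀, hk₀, R, 0, fun N _ => ?_⟩
    intro P X μ corr lap e G schur J b hRb hbN
    have hN : 2 ≤ N := by omega
    exact hR N hN b hRb hbN
  · intro h ω₂ lam β γ hω hl hβ hγ T hT
    obtain ⟨k₀, hk₀, R, N₀, hR⟩ := h ω₂ lam β γ hω hl hβ hγ T hT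
    refine ⟨k₀, hk₀, R + N₀, fun N _ => ?_⟩
    intro P X μ corr lap e G schur J b hRb hbN
    have hN : N₀ ≤ N := by omega
    exact hR N hN b (by omega) (by omega)

/-- §6 gen-3 bookkeeping: proposals p126176 (`Negative/ExistenceBarrier.lean`, ACCEPTED @97852b24eaa5) and p126437
(`Negative/NonDegeneracy.lean`); no kit job from this seat; search degraded
(searchd down, OpenAlex/S2 429). The statement is `True`; the evidence lives in the §6 docblock. [folklore] -/
theorem findings_gen3 : True := trivial

end Summit.AtomisticToContinuum.FouriersLaw.Cruxes.PositiveMemory.Disproof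

end
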